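import Summits.ResolutionOfSingularities.ResolutionOfSingularities.Theorems.HilbertSamuelEliminationSigmaMaxModificationsCorridor3WLadderStrataBirthsMovingDefs
import Summits.ResolutionOfSingularities.ResolutionOfSingularities.Theorems.HilbertSamuelEliminationSigmaMaxModificationsCorridor3WLadderLocalChains
import Summits.ResolutionOfSingularities.ResolutionOfSingularities.Theorems.HilbertSamuelEliminationSigmaMaxModificationsCorridor3WLadderStrataBirthsTopClose
import HarnessLib

/-!
# [OURS · L1 W4.2] `Corridor3WLadderStrataBirthsMoving` — the MOVING half of row (b-end): «LATE MOVING BIRTHS NEED LATE RULED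
# REBIRTHS» (W4.2 DEAL D13, a PROVED reduction)

Part 2/2 (PROOFS: label escape, the reduction, D13's target by name, corollaries); part 1/2 = `…Corridor3WLadderStrataBirthsMovingDefs`
(`HasSandwichAt`, `IsMovingBirthAt.exists_host`, rows `StrataCycleEndNoDepthJumps`, `StrataDepthDiscipline`). This file is def-free.

Crux chain w42 (`SigmaMaxModifications`, stmt-ResolutionOfSingularities-18506; conjunct `SigmaMaxModificationsCorridor3`,
stmt-ResolutionOfSingularities-19249, skeleton `w_ladder` v6/v7), res-L1-w42-plan-1 RULINGS v3.12-2 (J3) / v3.12-3 (O) DEAL D13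
«(b-end)₃ MOVING / SURFACE-CENTRE CASE» → res-type-040 (gen 18). OURS (cell res-hironaka, slot W4.2); NOT statements of
H. Hironaka's manuscript [Hironaka2017] nor of [CossartJannsenSaito2020]; AI-drafted, weaker than expert review. Helper file
`--supports stmt-ResolutionOfSingularities-19249` (counted 0). Every `theorem` is PROVED; the open content sits in ONE
`def … : Prop` row (`StrataCycleEndNoDepthJumps`, §2) — the second `def … : Prop` (`StrataDepthDiscipline`) is standard blow-up
geometry typed as a binder.

## The object

res-type-067's split of stub-4's cycle-end births row (b-end) `StrataCycleEndBirthsSettle` (p504439/…StrataBirths) into «no late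
FIBRE births» ∧ «no late MOVING births» (`…StrataBirthsTopDictionary`, p513551, join `strataCycleEndBirthsSettle_of_noFibre_noMoving`
PROVED) left the MOVING row `StrataCycleEndNoMovingBirths p 3 (QNe Q) (3 ≤ ē)` as D13: eventually, at blown-up CYCLE-END steps of a
moving never-isolated `ē ≥ 3` chain, no irreducible component `Z' ∋ x_{n+1}` of `X_{n+1}(ν)` is NEWBORN with a positive-dimensional
image (a curve `Z'` over a non-component curve `Γ ∋ x_n` inside the surface being blown up). plan-1 named the danger: THREAD
HOPPING — a local fact at the generic point `ζ_Γ` kills one thread, label bookkeeping alone restates the row.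

## What is proved (namespace `…Theorems.SigmaMaxModificationsCorridor3.Moving`)

* §1 `HasSandwichAt s Z` («`Z` has depth `≥ 2` at the marked point»: an irreducible closed `B` with `{x_n} ⊊ B ⊊ Z`) and the
  SANDWICH `IsMovingBirthAt.exists_host`: under the cycle invariant, at a cycle-end step a moving birth `Z'` has
  `B = closure f(Z')` inside ONE label-`j` component `S ∋ x_n` of the centre `Y_n^{(j)}` (`j` the treated label; births lie over
  the centre, stub-4 p504439; `support_eq_part_of_next_none`, p503069), with `{x_n} ⊊ B ⊊ S` — the host is a SURFACE of label
  `treatedLabel`. Corollary `not_isMovingBirthAt_of_forall_not_hasSandwichAt`: NO MOVING BIRTH when the centre's components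
  through `x_n` are CURVES (plan-1 (J1)'s second dichotomy lemma; nothing geometric assumed).
* §3 LABEL ESCAPE `treatedLabel_unbounded_of_centreIO_of_replaySettle`: under (c-geo) `StrataLineageInCentreIO` and (c-rep)
  `StrataReplayBlowupsSettle` the treated label is UNBOUNDED along a moving never-isolated chain (stub-4's Kőnig-on-label-`j`
  argument of p503885 re-run with an arbitrary bound) — so late moving births are hosted by surfaces of LATE labels, i.e. by
  lineages BORN THROUGH THE CHAIN POINTS at late stages.
* §4 THE REDUCTION `strataCycleEndNoMovingBirths_of_centreIO` (any `N`, `Q`, `G`, under `QNe Q`):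
  (c-geo) ∧ (c-rep) ∧ «no late fibre births» (`StrataCycleEndNoFibreBirths`, res-type-067 / D9) ∧ «no late depth jumps»
  (`StrataCycleEndNoDepthJumps`, §2) ∧ depth discipline (`StrataDepthDiscipline`, §2) ⇒ `StrataCycleEndNoMovingBirths`. Proof:
  no component of a late label through a chain point has depth `≥ 2` (induction on the stage: a dominating one would need a late
  depth JUMP inside the centre at a blown-up cycle-end step — discipline (b), (c-rep), (b-jump); a newborn one is born at a
  blown-up cycle end (`isBlownUp_of_birth`, (c-rep)) as a fibre birth (excluded) or a moving birth, of depth `≤ 1` by discipline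
  (a)); but the host of a late moving birth is exactly such a component. With (c-geo) discharged by the H-layer
  (`strataLineageInCentreIO_of_localChains`, p513904): `strataCycleEndNoMovingBirths_of_local`, D13's target BY NAME
  `strataCycleEndNoMovingBirths_three_of_local`, and the corollaries `strataCycleEndBirthsSettle_three_of_local` ((b-end)₃, via
  067's join), `strataBirthsSettle_three_of_local` ((b)₃, via stub-4's `strataBirthsSettle_of_replaySettle_of_cycleEnd`) and
  `wtopEvNonIsoM_qNe_of_local_births` (res-type-012's `WtopEvNonIsoM p (QNe Q)` via `wtopEvNonIsoM_of_localChains`). With res-D-pv-002's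
  D9 close `strataCycleEndNoFibreBirths_three_of_dictionary` (p516610) as `hF`, (b-end)₃ hangs on (c-rep)₃, `BirthDictionary3`, `NoRuledBirth3`,
  `CycleEndCentreDichotomy3`, (b-jump)₃ and the discipline (the by-name corollary is an additive rev once that module is built on the farm).

## What is NOT proved, and why the reduction is honest

`StrataCycleEndNoDepthJumps` (§2, OPEN) is the RULED phenomenon of res-type-067's `NoRuledBirth3` / `RuledBirthDatumD` read for a
DOMINATING component: a curve component `Z ∋ x_n` of the centre REBORN through `x_{n+1}` as a surface `Z' ⊆ π⁻¹(Z)` contains the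
whole fibre `ℙ(Dir_{x_n}/T_{x_n}Z) ≅ ℙ¹` over `x_n`, wholly near. So BOTH halves of (b-end)₃ now hang on the ONE graded claim «at late
curve-centre cycle ends the fibre `ℙ¹` over the chain point is not wholly near» (newborn = fibre birth, dominating = ruled
rebirth), plus (c-rep)₃ and the dischargeable discipline; thread hopping is converted into «ever-new surfaces need ever-new
births, and a surface lineage is born as a CURVE (moving birth) and must JUMP». `StrataDepthDiscipline` is believed (and consumed)
at level `N = 3` only.

k21 CAVEAT (res-L1-w42-plan-1 RULINGS v3.13-5, 2026-08-27): at `Q = QNonpointed` the CJS label strategy LOOPS on the trinomial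
`y³ + x₃⁵ + x₁⁶x₂⁶x₃` (hand-checked ×2, combinatorial kernel p516000), and on that walk the conclusion of the reduction is FALSE with exactly
ONE hypothesis failing, (c-rep)₃: in every period the crossing of the two newborn lines is a REPLAYED point blow-up, a plane is born in
its fibre, and that plane hosts the next two moving line births at its cycle end; «no late fibre births» (cycle ends), (b-jump) and the
discipline all HOLD on the walk. The theorems are `Q`-parametric and keep their value on the pointed / guarded scopes of skeleton v8.

References: CJS LNM 2270 Rem. 6.29 (1) pp. 91–92, p. 105, p. 107, Def. 3.1, Thm. 3.14, Lemma 6.30 [CossartJannsenSaito2020];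
Görtz–Wedhorn I Prop. 13.91 (3) [GortzWedhorn2020]; tree `…WLadderStrataLineages` (p500484), `…StrataLabels` (p503069),
`…StrataCentre` (p503885), `…StrataScope` (p504439), `…StrataBirths`, `…StrataBirthsTopDictionary` (p513551), `…LocalChainsDefs`
(p513323), `…LocalChains` (p513904), `…MovingIsoDefs` (p500943); HOME STATUS res-L1-w42-plan-1 RULINGS v3.12-2 (J)/(J3) 08:17:15Z,
v3.12-3 (N)–(S) 08:32:59Z; res-type-040 CUT 08:58:02Z.
-/

noncomputable section

set_option linter.dupNamespace false

open CategoryTheory AlgebraicGeometry TopologicalSpace Topology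
open Summit.ResolutionOfSingularities.ResolutionOfSingularities.Theorems.CampaignW42
open Literature.AlgebraicGeometry.Resolution Literature.RingTheory.HilbertSamuel
open Literature.AlgebraicGeometry.CossartJannsenSaito2020
open Summit.ResolutionOfSingularities.ResolutionOfSingularities.Theorems.SigmaMaxModificationsCorridor3

namespace Summit.ResolutionOfSingularities.ResolutionOfSingularities.Theorems.SigmaMaxModificationsCorridor3.Moving

universe u

variable {R : ∀ S : Scheme.{u}, CentreSeq S → Prop} {N : ℕ} {ν : ℕ → ℕ}

/-! ## §3. LABEL ESCAPE: under (c-geo) and (c-rep) the treated label is unbounded along a moving never-isolated chain -/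

/-- **THE TREATED LABEL IS UNBOUNDED along a moving, never-isolated chain, given (c-geo) and (c-rep)** (the label bookkeeping of
stub-4's `strataLineagesFinite_of_centreIO_of_replaySettle`, p503885, re-run with an arbitrary bound in place of a lineage's
label): were `treatedLabel (c n) ≤ ℓ` for all `n`, the monotone treated label would be eventually constant `= j`; past (c-rep)'s
stage every blow-up of the chain point is a cycle end for `j`, so `x_n ∈ Y_n^{(j)}` infinitely often, hence (parents of label-`j`
components through `x_{n+1}` are label-`j` components through `x_n`) at every late stage; Kőnig gives an infinite label-`j`
lineage through the chain points, inside the centre at every cycle end — against (c-geo).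
[cite: CossartJannsenSaito2020, Rem. 6.29 (1), p. 105, p. 107] -/
theorem treatedLabel_unbounded_of_centreIO_of_replaySettle {p N : ℕ} {Q : ℕ → (ℕ → ℕ) → ∀ X : Scheme.{u}, X → Prop}
    {G : MarkedStage.{u} → Prop} (hgeo : StrataLineageInCentreIO p N Q G) (hrep : StrataReplayBlowupsSettle p N Q G)
    {R : ∀ S : Scheme.{u}, CentreSeq S → Prop} (hRf : OracleFunctional R) (hRa : OracleAdmissible R) {ν : ℕ → ℕ}
    {X : Scheme.{u}} [IsLocallyNoetherian X] {x : X} (hX : IsMaximalOrigin p N ν X x) (hQ : Q N ν X x)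
    {c : ℕ → MarkedStage.{u}} (h0 : Reaches R N ν (MarkedStage.init X x) (c 0))
    (hstep : ∀ n, CanonicalNearStep R N ν (c n) (c (n + 1))) (hG : ∀ n, G (c n)) (hnI : ∀ n, ¬ Iso N (c n))
    (hmov : ∀ n, ∃ m, n ≤ m ∧ (c m).IsBlownUp R N ν) (ℓ : ℕ) : ∃ n, ℓ < treatedLabel N ν (c n) := by
  by_contra hbdd
  push Not at hbdd
  -- adapted from stub-4's `strataLineagesFinite_of_centreIO_of_replaySettle` (p503885), steps (1), (3)–(6)
  have hinv : ∀ n, LabelInv N ν (c n) := fun n =>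
    (labelInv_init (N := N) (ν := ν) X x).of_reaches (reaches_chain h0 hstep n)
  have hpt : ∀ n, (c n).pt ∈ Scheme.hsStratum (c n).W N ν := fun n =>
    pt_mem_hsStratum_of_reaches hX.mem_stratum (reaches_chain h0 hstep n)
  have hne : ∀ n, (Scheme.hsStratum (c n).W N ν).Nonempty := fun n => ⟨_, hpt n⟩
  have hmono : Monotone fun n => treatedLabel N ν (c n) :=
    monotone_nat_of_le_succ fun n => treatedLabel_le_of_step (hinv n) (hstep n) (hne (n + 1))
  obtain ⟨j, n₂, hj⟩ :=
    Summit.ResolutionOfSingularities.ResolutionOfSingularities.Cruxes.SigmaMaxModifications.MovingCompactnessLine.eventually_const_of_monotone_of_bounded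
      hmono hbdd
  obtain ⟨n₁, hn₁⟩ := hrep R hRf hRa ν X x hX hQ c h0 hstep hG hnI hmov
  have hjyear : ∀ n, n₂ ≤ n → j ≤ (c n).L.year := fun n hn => (hj n hn) ▸ treatedLabel_le_year (hinv n) (hne n)
  choose f hf using fun n => (hstep n).exists_stepProjection
  let T : ∀ n, Set (Set (c n).W) := fun n => {W | W ∈ componentsThrough N ν (c n) ∧ (c n).L.label W = j}
  set n₃ := max n₁ n₂ + 1 with hn₃
  have hparent : ∀ n, n₃ ≤ n → ∀ W' ∈ T (n + 1), closure ((f n).base '' W') ∈ T n := by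
    intro n hn W' ⟨hW', hlW'⟩
    have hne' : (c (n + 1)).L.label W' ≠ (c n).L.year + 1 := by
      rw [hlW']
      have := hjyear n (by omega)
      omega
    have hmem := (hf n).mem_componentsIn_of_label_ne hne'
    exact ⟨closure_image_mem_componentsThrough (hf n) hW' hmem, ((hf n).label_eq_of_mem hmem) ▸ hlW'⟩
  have hT_of_blownUp : ∀ n, n₃ ≤ n → (c n).IsBlownUp R N ν → (T n).Nonempty := by
    intro n hn hbu
    obtain ⟨C, P', hcs, hptC⟩ := hbu
    have hnone : (c (n + 1)).P = none := hn₁ n (by omega) ⟨C, P', hcs, hptC⟩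
    have hsupp := support_eq_part_of_next_none hRf (hstep n) hnone hcs
    rw [hsupp, hj n (by omega)] at hptC
    obtain ⟨W, hW, hlW, hxW⟩ := ((c n).L.mem_part_iff _ j _).mp hptC
    exact ⟨W, ⟨hW, hxW⟩, hlW⟩
  have hdesc : ∀ d n, n₃ ≤ n → (T (n + d)).Nonempty → (T n).Nonempty := by
    intro d
    induction d with
    | zero => exact fun n _ h => h
    | succ d ih =>
      intro n hn h
      obtain ⟨W', hW'⟩ := h
      exact ih n hn ⟨_, hparent (n + d) (by omega) W' hW'⟩
  have hTne : ∀ n, n₃ ≤ n → (T n).Nonempty := by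
    intro n hn
    obtain ⟨m, hnm, hbu⟩ := hmov n
    obtain ⟨d, rfl⟩ := Nat.exists_eq_add_of_le hnm
    exact hdesc d n hn (hT_of_blownUp (n + d) (by omega) hbu)
  let c' : ℕ → MarkedStage.{u} := fun n => c (n₃ + n)
  have hN : ∀ n, IsNoetherian (c' n).W := fun n => isNoetherian_of_reaches_init hX (reaches_chain h0 hstep (n₃ + n))
  let F : ℕ → Type u := fun n => ↥(T (n₃ + n))
  haveI : ∀ n, Finite (F n) := fun n => by
    haveI := hN n
    exact ((componentsThrough_finite (N := N) (ν := ν) (c' n)).subset fun _ h => h.1).to_subtype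
  haveI : ∀ n, Nonempty (F n) := fun n => (hTne (n₃ + n) (Nat.le_add_right _ _)).to_subtype
  obtain ⟨u, hu⟩ := exists_section_of_finite_nonempty (F := F) fun n W' =>
    ⟨closure ((f (n₃ + n)).base '' W'.1), hparent (n₃ + n) (Nat.le_add_right _ _) W'.1 W'.2⟩
  refine hgeo R hRf hRa ν X x hX hQ c' (reaches_chain h0 hstep n₃) (fun n => hstep (n₃ + n)) (fun n => hG _)
    (fun n => hnI _) (io_shift hmov n₃) ⟨fun n => (u n).1, fun n => (u n).2.1, fun n =>
      ⟨f (n₃ + n), hf (n₃ + n), congrArg Subtype.val (hu n)⟩, fun n => ?_⟩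
  obtain ⟨m, hnm, hnone⟩ := exists_next_none (c := c') (fun n => hstep (n₃ + n)) n
  obtain ⟨C, P', hln, x', hcs, -, -, -, -⟩ := hstep (n₃ + m)
  refine ⟨m, hnm, C, P', hcs, ?_⟩
  rw [support_eq_part_of_next_none hRf (hstep (n₃ + m)) hnone hcs, hj (n₃ + m) (by omega)]
  exact (c (n₃ + m)).L.subset_part (u m).2.1.1 (u m).2.2

/-! ## §4. THE REDUCTION: the moving half of (b-end) from (c-geo), (c-rep), «no late fibre births», «no late depth jumps» and the
depth discipline — PROVED; D13's target by name at `N = 3`, `G = (3 ≤ ē)` -/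

/-- **LATE MOVING BIRTHS NEED LATE RULED REBIRTHS — the moving half of (b-end) REDUCED, any level `N`, origin predicate `Q` and
grade `G`, under `ν ≠ Φ^{(N)}` (`QNe Q`).** Hypotheses: (c-geo) `StrataLineageInCentreIO`, (c-rep) `StrataReplayBlowupsSettle`,
res-type-067's «no late FIBRE births» `StrataCycleEndNoFibreBirths`, «no late DEPTH JUMPS» `StrataCycleEndNoDepthJumps` and the
depth discipline `StrataDepthDiscipline`. Proof: by §3 the treated label is unbounded, so a late moving birth is hosted
(`IsMovingBirthAt.exists_host`) by a surface `S ∋ x_n` (depth `≥ 2`) of a LATE label `j`; but NO component of a late label through a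
chain point has depth `≥ 2` — by induction on the stage: a late-label component `S' ∋ x_{n+1}` of depth `≥ 2` either dominates a
component `S ∋ x_n` of the same label, of depth `≤ 1` by induction, so (discipline (b)) `S` lies in the centre, `x_n` is blown up,
the step is a cycle end by (c-rep), and «no late depth jumps» gives `S` depth `≥ 2` — contradiction; or it is newborn, hence
(`isBlownUp_of_birth`, (c-rep)) born at a blown-up cycle-end step: a fibre birth (excluded) or a moving birth, of depth `≤ 1` by
discipline (a) — contradiction. [cite: CossartJannsenSaito2020, Rem. 6.29 (1), p. 92, p. 105] -/
theorem strataCycleEndNoMovingBirths_of_centreIO {p N : ℕ} {Q : ℕ → (ℕ → ℕ) → ∀ X : Scheme.{u}, X → Prop}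
    {G : MarkedStage.{u} → Prop} (hgeo : StrataLineageInCentreIO p N (QNe Q) G)
    (hrep : StrataReplayBlowupsSettle p N (QNe Q) G) (hF : StrataCycleEndNoFibreBirths p N (QNe Q) G)
    (hJ : StrataCycleEndNoDepthJumps p N (QNe Q) G) (hD : StrataDepthDiscipline p N (QNe Q) G) :
    StrataCycleEndNoMovingBirths p N (QNe Q) G := by
  intro R hRf hRa ν X _ x hX hQ c h0 hstep hG hnI hmov
  have hν : ν ≠ iterPSum N Phi := hQ.2
  obtain ⟨k, _, hinv⟩ := exists_cycleInv_chain hRa hν hX h0 hstep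
  have hlab : ∀ n, LabelInv N ν (c n) := fun n =>
    (labelInv_init (N := N) (ν := ν) X x).of_reaches (reaches_chain h0 hstep n)
  have hpt : ∀ n, (c n).pt ∈ Scheme.hsStratum (c n).W N ν := fun n =>
    pt_mem_hsStratum_of_reaches hX.mem_stratum (reaches_chain h0 hstep n)
  have hne : ∀ n, (Scheme.hsStratum (c n).W N ν).Nonempty := fun n => ⟨_, hpt n⟩
  have hyear : ∀ n, (c n).L.year = (c 0).L.year + n := by
    intro n
    induction n with
    | zero => rfl
    | succ n ih => rw [(hstep n).year_eq, ih]; omega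
  have hmono : Monotone fun n => treatedLabel N ν (c n) :=
    monotone_nat_of_le_succ fun n => treatedLabel_le_of_step (hlab n) (hstep n) (hne (n + 1))
  -- the stages past which the four eventual rows hold
  obtain ⟨n₁, hn₁⟩ := hrep R hRf hRa ν X x hX hQ c h0 hstep hG hnI hmov
  obtain ⟨n₂, hn₂⟩ := hF R hRf hRa ν X x hX hQ c h0 hstep hG hnI hmov
  obtain ⟨n₃, hn₃⟩ := hJ R hRf hRa ν X x hX hQ c h0 hstep hG hnI hmov
  have hDc := hD R hRf hRa ν X x hX hQ c h0 hstep hG hnI hmov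
  set M : ℕ := max n₁ (max n₂ n₃) with hM
  -- KEY: no component of a LATE label (`> year₀ + M + 1`) through a chain point has depth ≥ 2
  have key : ∀ n, ∀ S ∈ componentsThrough N ν (c n), (c 0).L.year + M + 1 < (c n).L.label S →
      ¬ HasSandwichAt (c n) S := by
    intro n
    induction n with
    | zero =>
      intro S _ hlate _
      have := (hlab 0).label_le_year S
      omega
    | succ n ih =>
      intro S' hS' hlate hsand
      -- the stage is late: `label S' ≤ year (c (n+1)) = year₀ + n + 1`
      have hle : (c (n + 1)).L.label S' ≤ (c 0).L.year + (n + 1) := (hyear (n + 1)) ▸ (hlab (n + 1)).label_le_year S'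
      have hnM : M < n + 1 := by omega
      have hn1 : n₁ ≤ n := by omega
      have hn2 : n₂ ≤ n := by omega
      have hn3 : n₃ ≤ n := by omega
      obtain ⟨f, hf⟩ := (hstep n).exists_stepProjection
      by_cases hdom : closure (f.base '' S') ∈ componentsIn (Scheme.hsStratum (c n).W N ν)
      · -- dominating: the parent has the same (late) label and, by induction, depth ≤ 1
        have hpar : closure (f.base '' S') ∈ componentsThrough N ν (c n) := closure_image_mem_componentsThrough hf hS' hdom
        have hlabpar : (c n).L.label (closure (f.base '' S')) = (c (n + 1)).L.label S' := (hf.label_eq_of_mem hdom).symm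
        have hnosand : ¬ HasSandwichAt (c n) (closure (f.base '' S')) := ih _ hpar (hlabpar ▸ hlate)
        -- discipline (b): the parent lies in the centre, so `x_n` is blown up; (c-rep): a cycle end; (b-jump): contradiction
        obtain ⟨C, P', hcs, hsub⟩ := (hDc n f hf).2 S' hS' hdom hsand hnosand
        have hbu : (c n).IsBlownUp R N ν := ⟨C, P', hcs, hsub hpar.2⟩
        have hnone : (c (n + 1)).P = none := hn₁ n hn1 hbu
        exact hnosand (hn₃ n hn3 hbu hnone f hf S' hS' hdom ⟨C, P', hcs, hsub⟩ hsand)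
      · -- newborn: born at a blown-up (births lie over the centre) cycle-end ((c-rep)) step; fibre or moving
        have hbu : (c n).IsBlownUp R N ν := isBlownUp_of_birth hRa hν (hinv n) hf hS' hdom
        have hnone : (c (n + 1)).P = none := hn₁ n hn1 hbu
        have hnew : IsNewbornAt N ν (c n) (c (n + 1)) f S' := ⟨hS', hdom⟩
        rcases hnew.fibre_or_moving with hfi | hmo
        · exact hn₂ n hn2 hbu hnone f hf S' hfi
        · exact (hDc n f hf).1 hnone S' hmo hsand
  -- a label bound for the treated label along the chain
  obtain ⟨nL, hnL⟩ := treatedLabel_unbounded_of_centreIO_of_replaySettle hgeo hrep hRf hRa hX hQ h0 hstep hG hnI hmov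
    ((c 0).L.year + M + 1)
  refine ⟨nL, fun n hn hbu hnone f hf Z' hZ' => ?_⟩
  -- the host surface of the moving birth has the (late) treated label and depth ≥ 2: contradiction with `key`
  obtain ⟨S, hS, hSl, -, -, -, hsand⟩ := hZ'.exists_host hRf hRa hν (hinv n) (hstep n) hnone hf
  have hlate : (c 0).L.year + M + 1 < (c n).L.label S := by
    rw [hSl]
    exact hnL.trans_le (hmono hn)
  exact key n S hS hlate hsand

/-- **The same with (c-geo) DISCHARGED at level `3` by the H-layer** (transfer (T) `MovingLineageLocalizesM p` and kill (K)
`LocalNearPointChainsTerminate`, `strataLineageInCentreIO_of_localChains`, p513904), any `Q`, any `G`.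
[cite: CossartJannsenSaito2020, Lemma 6.30, p. 98 Step 9, Rem. 6.29 (1)] -/
theorem strataCycleEndNoMovingBirths_of_local {p : ℕ} (hT : MovingLineageLocalizesM.{u} p)
    (hK : LocalNearPointChainsTerminate.{u}) {Q : ℕ → (ℕ → ℕ) → ∀ X : Scheme.{u}, X → Prop}
    {G : MarkedStage.{u} → Prop} (hrep : StrataReplayBlowupsSettle p 3 (QNe Q) G)
    (hF : StrataCycleEndNoFibreBirths p 3 (QNe Q) G) (hJ : StrataCycleEndNoDepthJumps p 3 (QNe Q) G)
    (hD : StrataDepthDiscipline p 3 (QNe Q) G) : StrataCycleEndNoMovingBirths p 3 (QNe Q) G :=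
  strataCycleEndNoMovingBirths_of_centreIO (strataLineageInCentreIO_of_localChains hT hK (QNe Q) G) hrep hF hJ hD

/-- **D13's TARGET BY NAME — `StrataCycleEndNoMovingBirths p 3 (QNe Q) (3 ≤ ē)` FROM THE LOCAL H-LAYER (T)+(K), (c-rep)₃, «no late
fibre births»₃ (res-type-067 / D9), «no late depth jumps»₃ and the depth discipline** (res-L1-w42-plan-1 RULINGS v3.12-2 (J3) /
v3.12-3 (O) D13). [cite: CossartJannsenSaito2020, Rem. 6.29 (1), Lemma 6.30, Thm. 3.14] -/
theorem strataCycleEndNoMovingBirths_three_of_local {p : ℕ} (hT : MovingLineageLocalizesM.{u} p)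
    (hK : LocalNearPointChainsTerminate.{u}) {Q : ℕ → (ℕ → ℕ) → ∀ X : Scheme.{u}, X → Prop}
    (hrep : StrataReplayBlowupsSettle p 3 (QNe Q) fun s => 3 ≤ s.geomDirDim)
    (hF : StrataCycleEndNoFibreBirths p 3 (QNe Q) fun s => 3 ≤ s.geomDirDim)
    (hJ : StrataCycleEndNoDepthJumps p 3 (QNe Q) fun s => 3 ≤ s.geomDirDim)
    (hD : StrataDepthDiscipline p 3 (QNe Q) fun s => 3 ≤ s.geomDirDim) :
    Moving.StrataCycleEndNoMovingBirths p 3 (QNe Q) (fun s => 3 ≤ s.geomDirDim) :=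
  strataCycleEndNoMovingBirths_of_local hT hK hrep hF hJ hD

/-- **COROLLARY — ROW (b-end)₃ ITSELF from the same inputs** (res-type-067's proved join
`strataCycleEndBirthsSettle_of_noFibre_noMoving`). [cite: CossartJannsenSaito2020, Rem. 6.29 (1), Thm. 3.14] -/
theorem strataCycleEndBirthsSettle_three_of_local {p : ℕ} (hT : MovingLineageLocalizesM.{u} p)
    (hK : LocalNearPointChainsTerminate.{u}) {Q : ℕ → (ℕ → ℕ) → ∀ X : Scheme.{u}, X → Prop}
    (hrep : StrataReplayBlowupsSettle p 3 (QNe Q) fun s => 3 ≤ s.geomDirDim)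
    (hF : StrataCycleEndNoFibreBirths p 3 (QNe Q) fun s => 3 ≤ s.geomDirDim)
    (hJ : StrataCycleEndNoDepthJumps p 3 (QNe Q) fun s => 3 ≤ s.geomDirDim)
    (hD : StrataDepthDiscipline p 3 (QNe Q) fun s => 3 ≤ s.geomDirDim) :
    StrataCycleEndBirthsSettle p 3 (QNe Q) (fun s => 3 ≤ s.geomDirDim) :=
  strataCycleEndBirthsSettle_of_noFibre_noMoving hF (strataCycleEndNoMovingBirths_three_of_local hT hK hrep hF hJ hD)

/-- **COROLLARY — ROW (b)₃ `StrataBirthsSettle p 3 (QNe Q) (3 ≤ ē)`** (stub-4's `strataBirthsSettle_of_replaySettle_of_cycleEnd`):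
births through the chain points settle, from (T), (K), (c-rep)₃, «no late fibre births»₃, «no late depth jumps»₃ and the depth
discipline. [cite: CossartJannsenSaito2020, Rem. 6.29 (1), p. 92] -/
theorem strataBirthsSettle_three_of_local {p : ℕ} (hT : MovingLineageLocalizesM.{u} p)
    (hK : LocalNearPointChainsTerminate.{u}) {Q : ℕ → (ℕ → ℕ) → ∀ X : Scheme.{u}, X → Prop}
    (hrep : StrataReplayBlowupsSettle p 3 (QNe Q) fun s => 3 ≤ s.geomDirDim)
    (hF : StrataCycleEndNoFibreBirths p 3 (QNe Q) fun s => 3 ≤ s.geomDirDim)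
    (hJ : StrataCycleEndNoDepthJumps p 3 (QNe Q) fun s => 3 ≤ s.geomDirDim)
    (hD : StrataDepthDiscipline p 3 (QNe Q) fun s => 3 ≤ s.geomDirDim) :
    StrataBirthsSettle p 3 (QNe Q) (fun s => 3 ≤ s.geomDirDim) :=
  strataBirthsSettle_of_replaySettle_of_cycleEnd hrep (strataCycleEndBirthsSettle_three_of_local hT hK hrep hF hJ hD)

/-- **COROLLARY — res-type-012's `WtopEvNonIsoM p (QNe Q)`** («no moving, never-isolated `ē ≥ 3` chain from a `QNe Q`-maximal
origin») from (T), (K), (c-rep)₃, «no late fibre births»₃, «no late depth jumps»₃ and the depth discipline (by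
`wtopEvNonIsoM_of_localChains`, p513904): the skeleton's `stub_WtopEvNonIsoM_nonpointed` at `Q = QNe QNonpointed` hangs on (c-rep)₃
and the ONE graded phenomenon behind `StrataCycleEndNoFibreBirths` / `StrataCycleEndNoDepthJumps` (plus the dischargeable
discipline). [cite: CossartJannsenSaito2020, Thm. 6.35, Lemma 6.30, Rem. 6.29 (1)] -/
theorem wtopEvNonIsoM_qNe_of_local_births {p : ℕ} (hT : MovingLineageLocalizesM.{u} p)
    (hK : LocalNearPointChainsTerminate.{u}) {Q : ℕ → (ℕ → ℕ) → ∀ X : Scheme.{u}, X → Prop}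
    (hrep : StrataReplayBlowupsSettle p 3 (QNe Q) fun s => 3 ≤ s.geomDirDim)
    (hF : StrataCycleEndNoFibreBirths p 3 (QNe Q) fun s => 3 ≤ s.geomDirDim)
    (hJ : StrataCycleEndNoDepthJumps p 3 (QNe Q) fun s => 3 ≤ s.geomDirDim)
    (hD : StrataDepthDiscipline p 3 (QNe Q) fun s => 3 ≤ s.geomDirDim) :
    Summit.ResolutionOfSingularities.ResolutionOfSingularities.Cruxes.SigmaMaxModifications.IdeasL1Idea2R4.WtopEvNonIsoM.{u}
      p (QNe Q) :=
  wtopEvNonIsoM_of_localChains hT hK (strataBirthsSettle_three_of_local hT hK hrep hF hJ hD) hrep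

/-! ## §5 (rev 2, append-only). (b-end)₃ and `WtopEvNonIsoM` FROM THE NAMED CLAIMS OF BOTH HALVES, BY NAME -/

/-- **COROLLARY — (b-end)₃ FROM THE NAMED CLAIMS OF BOTH HALVES**: res-D-pv-002's D9 close
`strataCycleEndNoFibreBirths_three_of_dictionary` (p516610: `BirthDictionary3` ∧ `NoRuledBirth3` ∧ `CycleEndCentreDichotomy3`, res-type-067
p515936) supplies «no late fibre births»; with (T), (K), (c-rep)₃, «no late depth jumps»₃ and the depth discipline this file supplies
«no late moving births»; 067's join gives the row. So (b-end)₃ at `QNe Q` hangs on: (c-rep)₃, the three named claims of the curve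
dictionary, ROW (b-jump) `StrataCycleEndNoDepthJumps` (res-D-brk-3's closer / step lemma p521156) and the dischargeable
`StrataDepthDiscipline` (res-type-053's bricks). Same k21 caveat at `Q = QNonpointed`. [cite: CossartJannsenSaito2020, Rem. 6.29 (1), Thm. 3.14] -/
theorem strataCycleEndBirthsSettle_three_of_dictionary_of_local {p : ℕ} (hT : MovingLineageLocalizesM.{u} p)
    (hK : LocalNearPointChainsTerminate.{u}) (hdict : BirthDictionary3.{u} p) (hrec : NoRuledBirth3.{u} p)
    (hdich : CycleEndCentreDichotomy3.{u} p) {Q : ℕ → (ℕ → ℕ) → ∀ X : Scheme.{u}, X → Prop}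
    (hrep : StrataReplayBlowupsSettle p 3 (QNe Q) fun s => 3 ≤ s.geomDirDim)
    (hJ : StrataCycleEndNoDepthJumps p 3 (QNe Q) fun s => 3 ≤ s.geomDirDim)
    (hD : StrataDepthDiscipline p 3 (QNe Q) fun s => 3 ≤ s.geomDirDim) :
    StrataCycleEndBirthsSettle p 3 (QNe Q) (fun s => 3 ≤ s.geomDirDim) :=
  strataCycleEndBirthsSettle_three_of_local hT hK hrep (strataCycleEndNoFibreBirths_three_of_dictionary hdict hrec hdich (QNe Q))
    hJ hD

/-- **COROLLARY — res-type-012's `WtopEvNonIsoM p (QNe Q)` from the same named claims** (stub-4's `strataBirthsSettle_of_replaySettle_of_cycleEnd`,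
`wtopEvNonIsoM_of_localChains`). Same k21 caveat at `Q = QNonpointed`. [cite: CossartJannsenSaito2020, Rem. 6.29 (1), Thm. 6.35] -/
theorem wtopEvNonIsoM_qNe_of_dictionary_of_local {p : ℕ} (hT : MovingLineageLocalizesM.{u} p)
    (hK : LocalNearPointChainsTerminate.{u}) (hdict : BirthDictionary3.{u} p) (hrec : NoRuledBirth3.{u} p)
    (hdich : CycleEndCentreDichotomy3.{u} p) {Q : ℕ → (ℕ → ℕ) → ∀ X : Scheme.{u}, X → Prop}
    (hrep : StrataReplayBlowupsSettle p 3 (QNe Q) fun s => 3 ≤ s.geomDirDim)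
    (hJ : StrataCycleEndNoDepthJumps p 3 (QNe Q) fun s => 3 ≤ s.geomDirDim)
    (hD : StrataDepthDiscipline p 3 (QNe Q) fun s => 3 ≤ s.geomDirDim) :
    Summit.ResolutionOfSingularities.ResolutionOfSingularities.Cruxes.SigmaMaxModifications.IdeasL1Idea2R4.WtopEvNonIsoM.{u}
      p (QNe Q) :=
  wtopEvNonIsoM_of_localChains hT hK
    (strataBirthsSettle_of_replaySettle_of_cycleEnd hrep
      (strataCycleEndBirthsSettle_three_of_dictionary_of_local hT hK hdict hrec hdich hrep hJ hD)) hrep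

end Summit.ResolutionOfSingularities.ResolutionOfSingularities.Theorems.SigmaMaxModificationsCorridor3.Moving

end
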